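import Mathlib
import HarnessLib
import Summits.HubbardSuperconductivity.HubbardSuperconductivity.Theorems.KLProgrammeC4aLatticeMomentumSum
import Summits.HubbardSuperconductivity.HubbardSuperconductivity.Theorems.KLProgrammeKLRegimeSplitSymInterpAliasingDeriv

/-!
# Route `KLProgramme` — crux C4a / stub (C) «(C)-B-REP» sup route, (R59bl) part 1: a smooth `D₄`-SYMMETRIC `2π`-periodic symbol on the momentum
# plane IS a cosine series `cosSeries c_F` (p2 g6's currency), with `c_F` = the sign-orbit sums of its `ℤ²` Fourier coefficients, and its
# ALIASING TAIL is the `ℤ²` tail `Σ_{|ν|_∞ > L/2} |F̂(ν)|·|ν|₁ʲ`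

Cell `gate-hubbard-kl`, lane hubbard-kl-c4a-1 (g4); pen (R59bl) (KL STATUS 2026-08-27 l.3734): the GENERIC aliasing-jet lemma for lattice data `(g·P)∘p`
is c4a-1's, on top of its LAYER-2 bricks; p2 g13 supplies the bridge/factor norms/assembly (spec HOME/p2-g13/SUP-ROUTE-SPEC-p2g13.md §2).
p2 g6's toolkit (`…SplitSymInterpAliasing(Deriv)`) proves, for data that are lattice samples of a COSINE SERIES `H = cosSeries c`
(`Σ'_{(m,n)} c(m,n)·h_{m,n}`), `‖Dʲ[evalM (symInterp L (H∘p))](q)‖ ≤ ‖Dʲ H(q)‖ + 2·aliasTail L c j`.  This file puts an ARBITRARY smooth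
`D₄`-symmetric `2π`-periodic `F : Momentum → ℝ` into that currency:

* §1 `signOrbit (m,n)` = the `≤ 4` frequencies `(±m, ±n) ∈ ℤ²`; `symbolFlat F hper` = the descent `F♭` of `y ↦ F(2πy)` to the unit torus (c4a-1's LAYER-2
  convention, `…C4aLatticeMomentumSum`); `cosCoeffOfSymbol F hper (m,n) := Σ_{ν ∈ signOrbit(m,n)} Re 𝓕F♭(ν)`;
* §2 Fourier inversion AT A POINT of the plane: `F(p) = Σ'_ν 𝓕F♭(ν)·e^{iν·p}` (Mathlib `hasSum_mFourier_series_apply_of_summable` through the descent);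
* §3 the `D₄` average of a character is the symmetrised harmonic: `¼Σ_{signs} e^{i(ε₀ν₀p₀+ε₁ν₁p₁)} = cos(ν₀p₀)cos(ν₁p₁)`, hence for `D₄`-symmetric `F`:
  `F(p) = Σ'_ν Re 𝓕F♭(ν)·h_{|ν₀|,|ν₁|}(p)`;
* §4 regrouping by sign orbits: **`cosSeries_cosCoeffOfSymbol`** — `cosSeries (cosCoeffOfSymbol F hper) p = F(p)`; weighted summability
  `summable_cosCoeffOfSymbol_weighted` from `Σ_ν ‖𝓕F♭(ν)‖(1+|ν|₁)^J < ∞`; **`aliasTail_cosCoeffOfSymbol_le`** — `aliasTail L c_F j ≤ Σ'_{ν : ∃ i, L/2 < |νᵢ|} ‖𝓕F♭(ν)‖·|ν|₁ʲ`;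
* §5 **`norm_iteratedFDeriv_evalM_symInterp_symbol_le`** — p2 g6's aliasing bound in `ℤ²` currency:
  `‖Dʲ[evalM (symInterp L (F∘p))](q)‖ ≤ ‖Dʲ F(q)‖ + 2·Σ'_{ν : ∃ i, L/2 < |νᵢ|} ‖𝓕F♭(ν)‖·|ν|₁ʲ`.

Part 2 (`…C4aAliasingJetProduct`) bounds the `ℤ²` tail for a PRODUCT `F = g·P` (trig poly `P` resolved by the grid × smooth `g`) by
`M_j(P̌)·Σ_{|η|_∞ > L/4}‖ĝ(η)‖(1+|η|₁)ʲ` and the latter by `‖∂^M g‖` (`Literature/Analysis/Fourier/TorusFourierTailSmooth` §2).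
Pure harmonic analysis on the tree's objects; nothing is asserted about the Hubbard model.  References: Boyd 2001 §4.5 Thm 19–20 [cite: Boyd2001];
Grafakos 2014 §3.3.3 [cite: Grafakos2014]; BGM 2006 §2.3 (2.17) [cite: BenfattoGiulianiMastropietro2006].
-/

noncomputable section

namespace Summit.HubbardSuperconductivity.HubbardSuperconductivity.Theorems.C4a

set_option linter.dupNamespace false -- summit = problem name (single-conjunct summit), D-0017

open Real Set MeasureTheory UnitAddTorus Finset
open Literature.Probability.LatticeModels Literature.MathematicalPhysics.QuantumLattice
open Literature.Analysis.Fourier Literature.Analysis.FunctionSpaces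
open Summit.HubbardSuperconductivity.HubbardSuperconductivity.Theorems.KLRegimeSplit

/-! ## §1 Sign orbits, the flat symbol, the cosine coefficients -/

/-- **The sign orbit of `(m,n)`**: the (at most four) frequencies `(±m, ±n) ∈ ℤ²`. -/
def signOrbit (mn : ℕ × ℕ) : Finset (Fin 2 → ℤ) :=
  (Finset.univ : Finset (Bool × Bool)).image fun e =>
    ![if e.1 then (mn.1 : ℤ) else -(mn.1 : ℤ), if e.2 then (mn.2 : ℤ) else -(mn.2 : ℤ)]

/-- Membership in the sign orbit: `ν ∈ signOrbit (m,n) ↔ |ν₀| = m ∧ |ν₁| = n`. -/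
theorem mem_signOrbit_iff (mn : ℕ × ℕ) (ν : Fin 2 → ℤ) : ν ∈ signOrbit mn ↔ (ν 0).natAbs = mn.1 ∧ (ν 1).natAbs = mn.2 := by
  constructor
  · intro h
    obtain ⟨e, -, rfl⟩ := Finset.mem_image.1 h
    constructor
    · simp only [Matrix.cons_val_zero]; split_ifs <;> simp
    · simp only [Matrix.cons_val_one, Matrix.cons_val_zero]; split_ifs <;> simp
  · rintro ⟨h0, h1⟩
    refine Finset.mem_image.2 ⟨(decide (0 ≤ ν 0), decide (0 ≤ ν 1)), Finset.mem_univ _, ?_⟩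
    funext i
    fin_cases i
    · simp only [Fin.zero_eta, Matrix.cons_val_zero]
      by_cases h : 0 ≤ ν 0
      · rw [decide_eq_true h, if_pos rfl, ← h0, Int.natCast_natAbs, abs_of_nonneg h]
      · rw [decide_eq_false h]; simp only [Bool.false_eq_true, ↓reduceIte]
        rw [← h0, Int.natCast_natAbs, abs_of_neg (not_le.1 h), neg_neg]
    · simp only [Fin.mk_one, Matrix.cons_val_one, Matrix.cons_val_zero]
      by_cases h : 0 ≤ ν 1
      · rw [decide_eq_true h, if_pos rfl, ← h1, Int.natCast_natAbs, abs_of_nonneg h]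
      · rw [decide_eq_false h]; simp only [Bool.false_eq_true, ↓reduceIte]
        rw [← h1, Int.natCast_natAbs, abs_of_neg (not_le.1 h), neg_neg]

/-- The absolute-value pair of a frequency. -/
def absPair (ν : Fin 2 → ℤ) : ℕ × ℕ := ((ν 0).natAbs, (ν 1).natAbs)

/-- The fibre of `absPair` over `(m,n)` is the sign orbit. -/
theorem absPair_preimage (mn : ℕ × ℕ) : absPair ⁻¹' {mn} = ↑(signOrbit mn) := by
  ext ν
  rw [Set.mem_preimage, Set.mem_singleton_iff, Finset.mem_coe, mem_signOrbit_iff, absPair, Prod.ext_iff]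

/-- The card of a sign orbit is at most `4`. -/
theorem card_signOrbit_le (mn : ℕ × ℕ) : (signOrbit mn).card ≤ 4 :=
  Finset.card_image_le.trans (by simp)

/-- On the sign orbit of `(m,n)` the `ℓ¹` size is `m + n`. -/
theorem sum_abs_eq_of_mem_signOrbit {mn : ℕ × ℕ} {ν : Fin 2 → ℤ} (h : ν ∈ signOrbit mn) :
    (|((ν 0 : ℤ) : ℝ)| + |((ν 1 : ℤ) : ℝ)|) = (mn.1 : ℝ) + mn.2 := by
  rw [mem_signOrbit_iff] at h
  rw [← h.1, ← h.2, Nat.cast_natAbs, Nat.cast_natAbs, Int.cast_abs, Int.cast_abs]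

section Flat

variable {F : Momentum → ℝ}

/-- The complexified, rescaled symbol `y ↦ F(2πy)` is `ℤ²`-periodic when `F` is `2π`-periodic. -/
theorem isLatticePeriodic_symbol (hper : ∀ (j : Fin 2) (q : Momentum), F (q + EuclideanSpace.single j (2 * π)) = F q) :
    Literature.Analysis.FunctionSpaces.Torus.IsLatticePeriodic (fun y : Momentum => ((F ((2 * π) • y) : ℝ) : ℂ)) :=
  isLatticePeriodic_rescale (Φ := fun q : Momentum => ((F q : ℝ) : ℂ)) fun j q => by simp only [hper]

/-- **The flat symbol `F♭`**: the descent of `y ↦ F(2πy)` (complexified) to the unit torus `(ℝ/ℤ)²` — c4a-1's LAYER-2 convention. -/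
def symbolFlat (F : Momentum → ℝ) (hper : ∀ (j : Fin 2) (q : Momentum), F (q + EuclideanSpace.single j (2 * π)) = F q) :
    UnitAddTorus (Fin 2) → ℂ :=
  Literature.Analysis.FunctionSpaces.Torus.descend (fun y : Momentum => ((F ((2 * π) • y) : ℝ) : ℂ)) (isLatticePeriodic_symbol hper)

/-- **The cosine coefficients of the symbol**: `c_F(m,n) := Σ_{ν ∈ signOrbit(m,n)} Re 𝓕F♭(ν)`. -/
def cosCoeffOfSymbol (F : Momentum → ℝ) (hper : ∀ (j : Fin 2) (q : Momentum), F (q + EuclideanSpace.single j (2 * π)) = F q)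
    (mn : ℕ × ℕ) : ℝ :=
  ∑ ν ∈ signOrbit mn, (mFourierCoeff (symbolFlat F hper) ν).re

/-- The flat symbol is continuous when `F` is. -/
theorem continuous_symbolFlat (hper : ∀ (j : Fin 2) (q : Momentum), F (q + EuclideanSpace.single j (2 * π)) = F q) (hF : Continuous F) :
    Continuous (symbolFlat F hper) :=
  continuous_descend (fun y : Momentum => ((F ((2 * π) • y) : ℝ) : ℂ)) (isLatticePeriodic_symbol hper)
    ((Complex.continuous_ofReal.comp hF).comp (continuous_const_smul (2 * π)))

/-- The flat symbol of a smooth symbol is smooth (Fourier coefficients absolutely summable). -/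
theorem summable_mFourierCoeff_symbolFlat (hper : ∀ (j : Fin 2) (q : Momentum), F (q + EuclideanSpace.single j (2 * π)) = F q)
    (hF : ContDiff ℝ (⊤ : ℕ∞) F) : Summable (mFourierCoeff (symbolFlat F hper)) :=
  summable_mFourierCoeff_descend_of_contDiff (fun y : Momentum => ((F ((2 * π) • y) : ℝ) : ℂ)) (isLatticePeriodic_symbol hper)
    ((Complex.ofRealCLM.contDiff.comp hF).comp (contDiff_const_smul (2 * π)))

/-! ## §2 Fourier inversion at a point of the plane -/

/-- The flat symbol at the projection of `(2π)⁻¹·p` is `F(p)`. -/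
theorem symbolFlat_proj (hper : ∀ (j : Fin 2) (q : Momentum), F (q + EuclideanSpace.single j (2 * π)) = F q) (p : Fin 2 → ℝ) :
    symbolFlat F hper (Literature.Analysis.FunctionSpaces.Torus.proj ((2 * π)⁻¹ • WithLp.toLp 2 p)) = ((F (WithLp.toLp 2 p) : ℝ) : ℂ) := by
  have h := congrFun (Literature.Analysis.FunctionSpaces.Torus.lift_descend_holds (fun y : Momentum => ((F ((2 * π) • y) : ℝ) : ℂ))
    (isLatticePeriodic_symbol hper)) ((2 * π)⁻¹ • WithLp.toLp 2 p)
  rw [Literature.Analysis.FunctionSpaces.Torus.lift, Function.comp_apply] at h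
  rw [symbolFlat, h, smul_smul, mul_inv_cancel₀ (by positivity), one_smul]

/-- The character `e_ν` at the projection of `(2π)⁻¹·p` is `exp(i ν·p)`. -/
theorem mFourier_proj (ν : Fin 2 → ℤ) (p : Fin 2 → ℝ) :
    mFourier ν (Literature.Analysis.FunctionSpaces.Torus.proj ((2 * π)⁻¹ • WithLp.toLp 2 p)) =
      Complex.exp (Complex.I * ∑ i : Fin 2, (ν i : ℂ) * (p i : ℂ)) := by
  rw [mFourier, ContinuousMap.coe_mk, Finset.mul_sum, Complex.exp_sum]
  refine Finset.prod_congr rfl fun i _ => ?_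
  rw [Literature.Analysis.FunctionSpaces.Torus.proj]
  simp only [PiLp.smul_apply, smul_eq_mul]
  rw [fourier_coe_apply]
  congr 1
  push_cast
  field_simp

end Flat

section Inversion

variable {F : Momentum → ℝ} (hper : ∀ (j : Fin 2) (q : Momentum), F (q + EuclideanSpace.single j (2 * π)) = F q)
  (hF : ContDiff ℝ (⊤ : ℕ∞) F)
include hF

/-- **Fourier inversion at a point of the plane**: `F(p) = Σ'_ν 𝓕F♭(ν)·exp(i ν·p)` (absolutely convergent for smooth `F`). -/
theorem hasSum_symbol_apply (p : Fin 2 → ℝ) :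
    HasSum (fun ν : Fin 2 → ℤ => mFourierCoeff (symbolFlat F hper) ν * Complex.exp (Complex.I * ∑ i : Fin 2, (ν i : ℂ) * (p i : ℂ)))
      ((F (WithLp.toLp 2 p) : ℝ) : ℂ) := by
  set f : C(UnitAddTorus (Fin 2), ℂ) := ⟨symbolFlat F hper, continuous_symbolFlat hper hF.continuous⟩ with hf
  have hsum : Summable (mFourierCoeff f) := summable_mFourierCoeff_symbolFlat hper hF
  have h := hasSum_mFourier_series_apply_of_summable hsum (Literature.Analysis.FunctionSpaces.Torus.proj ((2 * π)⁻¹ • WithLp.toLp 2 p))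
  have hfx : f (Literature.Analysis.FunctionSpaces.Torus.proj ((2 * π)⁻¹ • WithLp.toLp 2 p)) = ((F (WithLp.toLp 2 p) : ℝ) : ℂ) :=
    symbolFlat_proj hper p
  rw [hfx] at h
  refine h.congr_fun fun ν => ?_
  rw [smul_eq_mul, mFourier_proj]
  rfl

omit hF in
/-- The four sign images have the same value for a reflection- and swap-symmetric symbol. -/
theorem symbol_sign_images (hrefl : ∀ p : Fin 2 → ℝ, F (WithLp.toLp 2 ![p 0, -p 1]) = F (WithLp.toLp 2 p))
    (hswap : ∀ p : Fin 2 → ℝ, F (WithLp.toLp 2 ![p 1, p 0]) = F (WithLp.toLp 2 p)) (p : Fin 2 → ℝ) :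
    F (WithLp.toLp 2 ![p 0, -p 1]) = F (WithLp.toLp 2 p) ∧ F (WithLp.toLp 2 ![-p 0, p 1]) = F (WithLp.toLp 2 p) ∧
      F (WithLp.toLp 2 ![-p 0, -p 1]) = F (WithLp.toLp 2 p) := by
  refine ⟨hrefl p, ?_, ?_⟩
  · -- `(-p₀, p₁) = S (R (S p))`
    have h1 := hswap ![p 1, -p 0]
    have h2 := hrefl ![p 1, p 0]
    have h3 := hswap p
    simp only [Matrix.cons_val_zero, Matrix.cons_val_one] at h1 h2
    rw [h1, h2, h3]
  · -- `(-p₀, -p₁) = R (S (R (S p)))`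
    have h0 := hrefl ![-p 0, p 1]
    have h1 := hswap ![p 1, -p 0]
    have h2 := hrefl ![p 1, p 0]
    have h3 := hswap p
    simp only [Matrix.cons_val_zero, Matrix.cons_val_one] at h0 h1 h2
    rw [h0, h1, h2, h3]

omit hF in
/-- The trigonometric identity behind the sign average: `Σ_{ε ∈ {±1}²} e^{i(ε₀a + ε₁b)} = 4·cos a·cos b`. -/
theorem sum_sign_cexp (a b : ℝ) :
    Complex.exp (Complex.I * ((a : ℂ) + b)) + Complex.exp (Complex.I * ((a : ℂ) + -b)) +
        Complex.exp (Complex.I * (-(a : ℂ) + b)) + Complex.exp (Complex.I * (-(a : ℂ) + -b)) =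
      4 * ((Real.cos a : ℝ) : ℂ) * ((Real.cos b : ℝ) : ℂ) := by
  rw [Complex.ofReal_cos, Complex.ofReal_cos, Complex.cos, Complex.cos]
  have e1 : Complex.exp (Complex.I * ((a : ℂ) + b)) = Complex.exp ((a : ℂ) * Complex.I) * Complex.exp ((b : ℂ) * Complex.I) := by
    rw [← Complex.exp_add]; ring_nf
  have e2 : Complex.exp (Complex.I * ((a : ℂ) + -b)) = Complex.exp ((a : ℂ) * Complex.I) * Complex.exp (-(b : ℂ) * Complex.I) := by
    rw [← Complex.exp_add]; ring_nf
  have e3 : Complex.exp (Complex.I * (-(a : ℂ) + b)) = Complex.exp (-(a : ℂ) * Complex.I) * Complex.exp ((b : ℂ) * Complex.I) := by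
    rw [← Complex.exp_add]; ring_nf
  have e4 : Complex.exp (Complex.I * (-(a : ℂ) + -b)) = Complex.exp (-(a : ℂ) * Complex.I) * Complex.exp (-(b : ℂ) * Complex.I) := by
    rw [← Complex.exp_add]; ring_nf
  rw [e1, e2, e3, e4]
  ring

/-- **Sign average**: for a reflection/swap-symmetric smooth symbol, `F(p) = Σ'_ν 𝓕F♭(ν)·cos(ν₀p₀)cos(ν₁p₁)`. -/
theorem hasSum_symbol_cos_cos (hrefl : ∀ p : Fin 2 → ℝ, F (WithLp.toLp 2 ![p 0, -p 1]) = F (WithLp.toLp 2 p))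
    (hswap : ∀ p : Fin 2 → ℝ, F (WithLp.toLp 2 ![p 1, p 0]) = F (WithLp.toLp 2 p)) (p : Fin 2 → ℝ) :
    HasSum (fun ν : Fin 2 → ℤ => mFourierCoeff (symbolFlat F hper) ν *
        (((Real.cos ((ν 0 : ℝ) * p 0) : ℝ) : ℂ) * ((Real.cos ((ν 1 : ℝ) * p 1) : ℝ) : ℂ))) ((F (WithLp.toLp 2 p) : ℝ) : ℂ) := by
  obtain ⟨i1, i2, i3⟩ := symbol_sign_images hrefl hswap p
  have h1 := hasSum_symbol_apply hper hF p
  have h2 := hasSum_symbol_apply hper hF ![p 0, -p 1]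
  have h3 := hasSum_symbol_apply hper hF ![-p 0, p 1]
  have h4 := hasSum_symbol_apply hper hF ![-p 0, -p 1]
  rw [i1] at h2
  rw [i2] at h3
  rw [i3] at h4
  have hs := ((h1.add h2).add h3).add h4
  have h4F : (((F (WithLp.toLp 2 p) : ℝ) : ℂ) + ((F (WithLp.toLp 2 p) : ℝ) : ℂ) + ((F (WithLp.toLp 2 p) : ℝ) : ℂ) +
      ((F (WithLp.toLp 2 p) : ℝ) : ℂ)) = 4 * ((F (WithLp.toLp 2 p) : ℝ) : ℂ) := by ring
  rw [h4F] at hs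
  have hs' := hs.div_const 4
  rw [mul_div_cancel_left₀ _ (by norm_num : (4 : ℂ) ≠ 0)] at hs'
  refine hs'.congr_fun fun ν => ?_
  simp only [Fin.sum_univ_two, Matrix.cons_val_zero, Matrix.cons_val_one, Complex.ofReal_neg]
  have key := sum_sign_cexp ((ν 0 : ℝ) * p 0) ((ν 1 : ℝ) * p 1)
  push_cast at key ⊢
  rw [show Complex.I * ((ν 0 : ℂ) * (p 0 : ℂ) + (ν 1 : ℂ) * -(p 1 : ℂ)) = Complex.I * ((ν 0 : ℂ) * (p 0 : ℂ) + -((ν 1 : ℂ) * (p 1 : ℂ))) by ring,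
    show Complex.I * ((ν 0 : ℂ) * -(p 0 : ℂ) + (ν 1 : ℂ) * (p 1 : ℂ)) = Complex.I * (-((ν 0 : ℂ) * (p 0 : ℂ)) + (ν 1 : ℂ) * (p 1 : ℂ)) by ring,
    show Complex.I * ((ν 0 : ℂ) * -(p 0 : ℂ) + (ν 1 : ℂ) * -(p 1 : ℂ)) = Complex.I * (-((ν 0 : ℂ) * (p 0 : ℂ)) + -((ν 1 : ℂ) * (p 1 : ℂ))) by ring]
  rw [← mul_add, ← mul_add, ← mul_add, key]
  ring

/-- **`D₄` average = symmetrised harmonic**: `F(p) = Σ'_ν Re 𝓕F♭(ν)·h_{|ν₀|,|ν₁|}(p)` (real form). -/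
theorem hasSum_symbol_harmonic (hrefl : ∀ p : Fin 2 → ℝ, F (WithLp.toLp 2 ![p 0, -p 1]) = F (WithLp.toLp 2 p))
    (hswap : ∀ p : Fin 2 → ℝ, F (WithLp.toLp 2 ![p 1, p 0]) = F (WithLp.toLp 2 p)) (p : Fin 2 → ℝ) :
    HasSum (fun ν : Fin 2 → ℤ => (mFourierCoeff (symbolFlat F hper) ν).re * TrigPolyC4v.harmonic (ν 0).natAbs (ν 1).natAbs p)
      (F (WithLp.toLp 2 p)) := by
  have h1 := hasSum_symbol_cos_cos hper hF hrefl hswap p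
  have h2 := hasSum_symbol_cos_cos hper hF hrefl hswap ![p 1, p 0]
  rw [hswap p] at h2
  simp only [Matrix.cons_val_zero, Matrix.cons_val_one] at h2
  have hs := (h1.add h2).div_const 2
  have hre := Complex.hasSum_re hs  -- real parts
  have hval : (((((F (WithLp.toLp 2 p) : ℝ) : ℂ) + ((F (WithLp.toLp 2 p) : ℝ) : ℂ)) / 2).re) = F (WithLp.toLp 2 p) := by
    rw [← Complex.ofReal_add, ← Complex.ofReal_ofNat, ← Complex.ofReal_div, Complex.ofReal_re]; ring
  rw [hval] at hre
  refine hre.congr_fun fun ν => ?_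
  have hcos0 : Real.cos (((ν 0).natAbs : ℝ) * p 0) = Real.cos ((ν 0 : ℝ) * p 0) := by
    rw [Nat.cast_natAbs, Int.cast_abs]; rcases abs_choice (ν 0 : ℝ) with h | h <;> rw [h]; rw [neg_mul, Real.cos_neg]
  have hcos1 : Real.cos (((ν 1).natAbs : ℝ) * p 1) = Real.cos ((ν 1 : ℝ) * p 1) := by
    rw [Nat.cast_natAbs, Int.cast_abs]; rcases abs_choice (ν 1 : ℝ) with h | h <;> rw [h]; rw [neg_mul, Real.cos_neg]
  have hcos0' : Real.cos (((ν 0).natAbs : ℝ) * p 1) = Real.cos ((ν 0 : ℝ) * p 1) := by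
    rw [Nat.cast_natAbs, Int.cast_abs]; rcases abs_choice (ν 0 : ℝ) with h | h <;> rw [h]; rw [neg_mul, Real.cos_neg]
  have hcos1' : Real.cos (((ν 1).natAbs : ℝ) * p 0) = Real.cos ((ν 1 : ℝ) * p 0) := by
    rw [Nat.cast_natAbs, Int.cast_abs]; rcases abs_choice (ν 1 : ℝ) with h | h <;> rw [h]; rw [neg_mul, Real.cos_neg]
  simp only [TrigPolyC4v.harmonic, hcos0, hcos1, hcos0', hcos1']
  rw [← Complex.ofReal_mul, ← Complex.ofReal_mul, ← mul_add, mul_div_assoc, ← Complex.ofReal_add, ← Complex.ofReal_ofNat,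
    ← Complex.ofReal_div, Complex.re_mul_ofReal]
  ring

end Inversion

/-! ## §4 Regrouping by sign orbits: the symbol IS `cosSeries c_F`; weighted summability; the aliasing tail -/

/-- **Fibrewise regrouping over sign orbits**: a convergent `ℤ²`-series is the `ℕ²`-series of its sign-orbit sums. -/
theorem hasSum_signOrbit_fiberwise {g : (Fin 2 → ℤ) → ℝ} {a : ℝ} (h : HasSum g a) :
    HasSum (fun mn : ℕ × ℕ => ∑ ν ∈ signOrbit mn, g ν) a := by
  have h1 := h.tsum_fiberwise absPair
  refine h1.congr_fun fun mn => ?_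
  show ∑ ν ∈ signOrbit mn, g ν = ∑' ν : ↥(absPair ⁻¹' {mn}), g ν
  rw [absPair_preimage mn, Finset.tsum_subtype']

/-- Summable version of the regrouping, for nonnegative families: `Σ'_{mn} Σ_{ν ∈ signOrbit mn} g ν = Σ'_ν g ν` and the regrouped family is summable. -/
theorem summable_signOrbit_fiberwise {g : (Fin 2 → ℤ) → ℝ} (h : Summable g) :
    Summable (fun mn : ℕ × ℕ => ∑ ν ∈ signOrbit mn, g ν) ∧ ∑' mn : ℕ × ℕ, ∑ ν ∈ signOrbit mn, g ν = ∑' ν, g ν :=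
  ⟨(hasSum_signOrbit_fiberwise h.hasSum).summable, (hasSum_signOrbit_fiberwise h.hasSum).tsum_eq⟩

section Regroup

variable {F : Momentum → ℝ} (hper : ∀ (j : Fin 2) (q : Momentum), F (q + EuclideanSpace.single j (2 * π)) = F q)
  (hF : ContDiff ℝ (⊤ : ℕ∞) F)
  (hrefl : ∀ p : Fin 2 → ℝ, F (WithLp.toLp 2 ![p 0, -p 1]) = F (WithLp.toLp 2 p))
  (hswap : ∀ p : Fin 2 → ℝ, F (WithLp.toLp 2 ![p 1, p 0]) = F (WithLp.toLp 2 p))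
include hF hrefl hswap

/-- **THE SYMBOL IS A COSINE SERIES**: `cosSeries (cosCoeffOfSymbol F hper) p = F(p)` for a smooth `D₄`-symmetric `2π`-periodic `F`. -/
theorem cosSeries_cosCoeffOfSymbol (p : Fin 2 → ℝ) : cosSeries (cosCoeffOfSymbol F hper) p = F (WithLp.toLp 2 p) := by
  have h := hasSum_signOrbit_fiberwise (hasSum_symbol_harmonic hper hF hrefl hswap p)
  rw [cosSeries]
  refine (HasSum.tsum_eq ?_)
  refine h.congr_fun fun mn => ?_
  show cosCoeffOfSymbol F hper mn * TrigPolyC4v.harmonic mn.1 mn.2 p = ∑ ν ∈ signOrbit mn, _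
  rw [cosCoeffOfSymbol, Finset.sum_mul]
  refine Finset.sum_congr rfl fun ν hν => ?_
  obtain ⟨h1, h2⟩ := (mem_signOrbit_iff mn ν).1 hν
  simp only [h1, h2]

omit hF hrefl hswap in
/-- **Weighted summability of the cosine coefficients** from the weighted summability of the `ℤ²` coefficients:
`Σ_ν ‖𝓕F♭(ν)‖(1 + |ν|₁)^J < ∞ ⟹ Σ_{(m,n)} |c_F(m,n)|(1+m+n)^J < ∞` (on a sign orbit `|ν|₁ = m + n`). -/
theorem summable_cosCoeffOfSymbol_weighted {J : ℕ}
    (hw : Summable fun ν : Fin 2 → ℤ => ‖mFourierCoeff (symbolFlat F hper) ν‖ * (1 + ∑ i, |(ν i : ℝ)|) ^ J) :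
    Summable fun mn : ℕ × ℕ => |cosCoeffOfSymbol F hper mn| * (1 + (mn.1 : ℝ) + mn.2) ^ J := by
  have hmaj := (summable_signOrbit_fiberwise hw).1
  refine Summable.of_nonneg_of_le (fun mn => by positivity) (fun mn => ?_) hmaj
  rw [cosCoeffOfSymbol]
  calc |∑ ν ∈ signOrbit mn, (mFourierCoeff (symbolFlat F hper) ν).re| * (1 + (mn.1 : ℝ) + mn.2) ^ J
      ≤ (∑ ν ∈ signOrbit mn, |(mFourierCoeff (symbolFlat F hper) ν).re|) * (1 + (mn.1 : ℝ) + mn.2) ^ J :=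
        mul_le_mul_of_nonneg_right (Finset.abs_sum_le_sum_abs _ _) (by positivity)
    _ = ∑ ν ∈ signOrbit mn, |(mFourierCoeff (symbolFlat F hper) ν).re| * (1 + (mn.1 : ℝ) + mn.2) ^ J := Finset.sum_mul _ _ _
    _ ≤ ∑ ν ∈ signOrbit mn, ‖mFourierCoeff (symbolFlat F hper) ν‖ * (1 + ∑ i, |(ν i : ℝ)|) ^ J := by
        refine Finset.sum_le_sum fun ν hν => ?_
        have h1 : (1 + (mn.1 : ℝ) + mn.2) = 1 + ∑ i, |(ν i : ℝ)| := by
          rw [Fin.sum_univ_two, sum_abs_eq_of_mem_signOrbit hν]; ring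
        rw [h1]
        exact mul_le_mul_of_nonneg_right (Complex.abs_re_le_norm _) (by positivity)

omit hF hrefl hswap in
/-- **The aliasing tail of the cosine coefficients is the `ℤ²` tail**:
`aliasTail L c_F j ≤ Σ'_ν [L/2 < |ν₀| ∨ L/2 < |ν₁|] ‖𝓕F♭(ν)‖·(|ν₀| + |ν₁|)ʲ` (`j ≤ J`, under the order-`J` weighted summability). -/
theorem aliasTail_cosCoeffOfSymbol_le (L : ℕ) {J : ℕ}
    (hw : Summable fun ν : Fin 2 → ℤ => ‖mFourierCoeff (symbolFlat F hper) ν‖ * (1 + ∑ i, |(ν i : ℝ)|) ^ J) {j : ℕ} (hj : j ≤ J) :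
    aliasTail L (cosCoeffOfSymbol F hper) j ≤
      ∑' ν : Fin 2 → ℤ, (if (L / 2 < (ν 0).natAbs ∨ L / 2 < (ν 1).natAbs) then
        ‖mFourierCoeff (symbolFlat F hper) ν‖ * (|((ν 0 : ℤ) : ℝ)| + |((ν 1 : ℤ) : ℝ)|) ^ j else 0) := by
  -- the `ℤ²` tail family is summable (below the order-`J` weights)
  have htail : Summable fun ν : Fin 2 → ℤ => (if (L / 2 < (ν 0).natAbs ∨ L / 2 < (ν 1).natAbs) then
      ‖mFourierCoeff (symbolFlat F hper) ν‖ * (|((ν 0 : ℤ) : ℝ)| + |((ν 1 : ℤ) : ℝ)|) ^ j else 0) := by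
    refine Summable.of_nonneg_of_le (fun ν => by positivity) (fun ν => ?_) hw
    have hle : (|((ν 0 : ℤ) : ℝ)| + |((ν 1 : ℤ) : ℝ)|) ^ j ≤ (1 + ∑ i, |(ν i : ℝ)|) ^ J := by
      rw [Fin.sum_univ_two]
      have h0 : 0 ≤ |((ν 0 : ℤ) : ℝ)| + |((ν 1 : ℤ) : ℝ)| := by positivity
      calc (|((ν 0 : ℤ) : ℝ)| + |((ν 1 : ℤ) : ℝ)|) ^ j ≤ (1 + (|((ν 0 : ℤ) : ℝ)| + |((ν 1 : ℤ) : ℝ)|)) ^ j :=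
            pow_le_pow_left₀ h0 (by linarith) j
        _ ≤ (1 + (|((ν 0 : ℤ) : ℝ)| + |((ν 1 : ℤ) : ℝ)|)) ^ J := pow_le_pow_right₀ (by linarith) hj
    split_ifs
    · exact mul_le_mul_of_nonneg_left hle (norm_nonneg _)
    · positivity
  obtain ⟨hmaj, heq⟩ := summable_signOrbit_fiberwise htail
  rw [← heq, aliasTail]
  refine Summable.tsum_le_tsum (fun mn => ?_) (summable_aliasTail_term L (summable_cosCoeffOfSymbol_weighted hper hw) hj) hmaj
  split_ifs with hmn
  · rw [cosCoeffOfSymbol]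
    calc |∑ ν ∈ signOrbit mn, (mFourierCoeff (symbolFlat F hper) ν).re| * ((mn.1 : ℝ) + mn.2) ^ j
        ≤ (∑ ν ∈ signOrbit mn, |(mFourierCoeff (symbolFlat F hper) ν).re|) * ((mn.1 : ℝ) + mn.2) ^ j :=
          mul_le_mul_of_nonneg_right (Finset.abs_sum_le_sum_abs _ _) (by positivity)
      _ = ∑ ν ∈ signOrbit mn, |(mFourierCoeff (symbolFlat F hper) ν).re| * ((mn.1 : ℝ) + mn.2) ^ j := Finset.sum_mul _ _ _
      _ ≤ ∑ ν ∈ signOrbit mn, (if (L / 2 < (ν 0).natAbs ∨ L / 2 < (ν 1).natAbs) then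
            ‖mFourierCoeff (symbolFlat F hper) ν‖ * (|((ν 0 : ℤ) : ℝ)| + |((ν 1 : ℤ) : ℝ)|) ^ j else 0) := by
          refine Finset.sum_le_sum fun ν hν => ?_
          have hν' := (mem_signOrbit_iff mn ν).1 hν
          rw [if_pos (by rw [hν'.1, hν'.2]; exact hmn), sum_abs_eq_of_mem_signOrbit hν]
          exact mul_le_mul_of_nonneg_right (Complex.abs_re_le_norm _) (by positivity)
  · exact Finset.sum_nonneg fun ν _ => by positivity

/-! ## §5 The aliasing bound for derivatives, `ℤ²` currency -/

/-- **THE ALIASING BOUND FOR DERIVATIVES OF THE INTERPOLANT OF LATTICE SAMPLES OF A SMOOTH `D₄`-SYMMETRIC SYMBOL** (p2 g6's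
`norm_iteratedFDeriv_evalM_symInterp_cosSeries_le` in `ℤ²` currency): for `j ≤ J`, at every continuum momentum `q`,
`‖Dʲ[evalM (symInterp L (F∘p))](q)‖ ≤ ‖Dʲ F(q)‖ + 2·Σ'_ν [L/2 < |ν₀| ∨ L/2 < |ν₁|] ‖𝓕F♭(ν)‖·(|ν₀|+|ν₁|)ʲ`. -/
theorem norm_iteratedFDeriv_evalM_symInterp_symbol_le {L : ℕ} [NeZero L] {J : ℕ}
    (hw : Summable fun ν : Fin 2 → ℤ => ‖mFourierCoeff (symbolFlat F hper) ν‖ * (1 + ∑ i, |(ν i : ℝ)|) ^ J)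
    {j : ℕ} (hj : j ≤ J) (q : Momentum) :
    ‖iteratedFDeriv ℝ j (evalM (symInterp L (fun k : TorusSite 2 L => F (WithLp.toLp 2 (latticeMomentum L k))))) q‖ ≤
      ‖iteratedFDeriv ℝ j F q‖ +
        2 * ∑' ν : Fin 2 → ℤ, (if (L / 2 < (ν 0).natAbs ∨ L / 2 < (ν 1).natAbs) then
          ‖mFourierCoeff (symbolFlat F hper) ν‖ * (|((ν 0 : ℤ) : ℝ)| + |((ν 1 : ℤ) : ℝ)|) ^ j else 0) := by
  have hc := summable_cosCoeffOfSymbol_weighted hper hw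
  have key := norm_iteratedFDeriv_evalM_symInterp_cosSeries_le (L := L) hc hj q
  have hdata : (fun k : TorusSite 2 L => cosSeries (cosCoeffOfSymbol F hper) (latticeMomentum L k)) =
      fun k : TorusSite 2 L => F (WithLp.toLp 2 (latticeMomentum L k)) :=
    funext fun k => cosSeries_cosCoeffOfSymbol hper hF hrefl hswap _
  have hsym : (fun q : Momentum => cosSeries (cosCoeffOfSymbol F hper) (WithLp.ofLp q)) = F := by
    funext q; rw [cosSeries_cosCoeffOfSymbol hper hF hrefl hswap]
  rw [hdata, hsym] at key
  have htail := aliasTail_cosCoeffOfSymbol_le hper L hw hj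
  linarith

end Regroup

end Summit.HubbardSuperconductivity.HubbardSuperconductivity.Theorems.C4a

end
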